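/-
Copyright (c) 2026. All rights reserved.
Released under Apache 2.0 license as described in the file LICENSE.
Authors: HodgeCM publication cell (pub-hodgecm), model-construction sub-cell, construction prover `mc-unitary-3`.
-/
import Literature.NumberTheory.Weil1964.AdelicMetaplecticContinuous
import Literature.NumberTheory.Automorphic.UnitaryGroupSymplecticCarriers
import HarnessLib

/-!
# Transport of structure for `Mp_ψ(W)` and the relabelling `Mp_ψ(W_{T′}) ≃ Mp_ψ(W_T)` of the adelic model

[MoeglinVignerasWaldspurger1987, Chap. 2 II.1 (A)–(B)] attach to a model `ρ` of the Heisenberg representation the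
group `S̃p_ψ(W) = {(g, M) : M ρ(h) M⁻¹ = ρ(g h)}` with its projection `(g, M) ↦ g` and its tautological ("Weil")
representation `(g, M) ↦ M` ([GelbartRogawski1991, §3.1 p. 454]: "`ω_ψ(g, M_g) = M_g`"); the tree's `MpPsi ρ`,
`MpPsi.proj`, `MpPsi.toOp`, `omegaPsi` (`LocalWeilProjective`, `AdelicMetaplecticGroup`).  The construction is
NATURAL in the pair (symplectic space, model): an isomorphism of the data transports the group, the projection and
the Weil representation.  This file records that naturality (§1) and its instance of record for the global
Schrödinger model `ρ_T` on `𝒮(𝔸_F^ι)` of `AdelicHeisenbergSchrodinger` (§2–§3): the Gram matrix `T` of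
`W_T = (𝔸_F^ι × 𝔸_F^ι, polar β_T)`, `β_T(x, y) = x ⬝ᵥ (T y)`, enters `ρ_T` ONLY through `T y`
(`adelicSchrodinger_apply`: `(ρ_T((x, y), t)Φ)(u) = ψ_F(t + u ⬝ᵥ (T y)) Φ(u + x)`), so for `T C = T′` the relabelling
`Λ_C : ((x, y), t) ↦ ((x, C y), t)` is an isomorphism `H(W_{T′}) ≃ H(W_T)` along which `ρ_T ∘ Λ_C = ρ_{T′}` — the SAME
operators.  Hence `(g, M) ↦ (Λ_C g Λ_C⁻¹, M)` is an isomorphism `Mp_ψ(W_{T′}) ≃ Mp_ψ(W_T)` preserving the operator,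
the `Θ`-fixing subgroup, the LF-continuous subgroup of record `Mp_ψ(W_𝔸)ᶜᵒⁿᵗ` and the coefficient topology.

## What is here (sorry-free; no new Literature facts)

§1 GENERIC TRANSPORT for weil-1's `MpPsi` — data: `θ : V′ ≃ₗ[R] V` with `B (θ v) (θ w) = B′ v w` and
`A : S′ ≃ₗ[k] S` with `A (ρ′ h f) = ρ (heisenbergCongr θ h) (A f)`:
* `heisenbergCongr θ hθ : Heisenberg B′ ≃* Heisenberg B`, `⟨v, t⟩ ↦ ⟨θ v, t⟩`; it commutes with Weil's section
  `ofSymplectic` and unitary-2's `symplecticGroupCongr` (`heisenbergCongr_act`);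
* `MpPsi.transport ρ ρ′ θ hθ A hA : MpPsi ρ′ ≃* MpPsi ρ`, `(g, M) ↦ (θ g θ⁻¹, A M A⁻¹)`, with the `rfl`-level formulas
  `MpPsi.proj_transport`, `MpPsi.toOp_transport(_apply)`, `omegaPsi_transport_apply`, and
  `MpPsi.transport_mem_fixing_iff : transport p ∈ fixing ρ Θ ↔ p ∈ fixing ρ′ Θ′` whenever `Θ ∘ A = Θ′`.
§2 THE RELABELLING of the adelic model (any finite index type `ι`): `C : GL_ι(𝔸_F)` with `hC : T * C = T′`
(`relabelGL`: `C := T⁻¹ T′` for invertible `T, T′`), `relabelVec C : (x, y) ↦ (x, C y)`, `polar_relabelVec`,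
`adelicSchrodinger_relabel : ρ_T (heisenbergCongr Λ_C h) = ρ_{T′} h`, and
`adelicMpRelabel C hC : adelicMp F ι T′ ≃* adelicMp F ι T` with `toOp_adelicMpRelabel : toOp (relabel p) = toOp p`,
`omegaPsi_adelicMpRelabel`, `proj_adelicMpRelabel` (`= symplecticGroupCongr Λ_C (proj p)`, pointwise
`coe_proj_adelicMpRelabel_apply`), `adelicMpRelabel_mem_adelicMpCont_iff`, `adelicMpRelabel_mem_adelicMpTheta_iff`
(`Θ`-fixing is preserved for EVERY `C` — the operator does not move), `continuous_adelicMpRelabel`, and the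
uniqueness statement against `Θ`-fixing lifts `adelicMpRelabel_eq_of_proj_eq` (`adelicMp_eq_of_proj_eq`).
§3 THE SAME ON THE GROUP OF RECORD: `adelicMpContRelabel C hC : adelicMpCont F ι T′ ≃* adelicMpCont F ι T` with
`adelicMpCont.omega_relabel`, `adelicMpCont.proj_relabel`, `coe_adelicMpContRelabel_mem_adelicMpTheta_iff`,
`continuous_adelicMpContRelabel`.

Consumers (publication cell, junction `E`): a splitting `s : G →* Mp_ψ(W_{T′})ᶜᵒⁿᵗ` over one Gram matrix is moved
to another by `adelicMpContRelabel C hC ∘ s`; its Weil representation is unchanged and its projection is conjugated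
by `Λ_C`; a rational symplectic isometry between the two forms is then absorbed by Weil's `Θ`-fixing rational lift
(`AdelicMetaplecticGroup` §3, `GelbartRogawski1991/UnitaryDualPairSplittingDatum.ratSection`) inside ONE group, by
`adelicMpRelabel_eq_of_proj_eq`.
-/

set_option autoImplicit false

noncomputable section

open NumberField
open scoped Matrix

namespace Literature.NumberTheory.Weil1964

open Literature.RepresentationTheory.HeisenbergGroup Literature.NumberTheory.Automorphic
open Literature.NumberTheory.Automorphic.UnitaryGroup (symplecticGroupCongr coe_symplecticGroupCongr_apply)
open Literature.GroupTheory.TwistedProduct (fixer mem_fixer_iff)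

/-! ## §1 Transport of structure for `MpPsi` along an isomorphism of (form, model) -/

section Generic

variable {R : Type*} [CommRing R] {V : Type*} [AddCommGroup V] [Module R V] {V' : Type*} [AddCommGroup V']
  [Module R V'] {B : V →ₗ[R] V →ₗ[R] R} {B' : V' →ₗ[R] V' →ₗ[R] R}
variable (θ : V' ≃ₗ[R] V) (hθ : ∀ v w, B (θ v) (θ w) = B' v w)

/-- **Transport of Heisenberg groups** along a form-compatible linear isomorphism `θ : (V′, B′) ≃ (V, B)`:
`(v, t) ↦ (θ v, t)` (the law `(v,t)(v′,t′) = (v + v′, t + t′ + B v v′)` is preserved because `B (θ v) (θ v′) = B′ v v′`).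
[cite: MoeglinVignerasWaldspurger1987, Chap. 2 I.1] -/
def heisenbergCongr : Heisenberg B' ≃* Heisenberg B where
  toFun h := ⟨θ h.v, h.t⟩
  invFun h := ⟨θ.symm h.v, h.t⟩
  left_inv h := Heisenberg.ext (θ.symm_apply_apply h.v) rfl
  right_inv h := Heisenberg.ext (θ.apply_symm_apply h.v) rfl
  map_mul' h h' := Heisenberg.ext (map_add θ h.v h'.v) (by simp [hθ])

/-- vector component of the transport. [folklore] -/
@[simp] theorem heisenbergCongr_v (h : Heisenberg B') : (heisenbergCongr θ hθ h).v = θ h.v := rfl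

/-- central component of the transport. [folklore] -/
@[simp] theorem heisenbergCongr_t (h : Heisenberg B') : (heisenbergCongr θ hθ h).t = h.t := rfl

/-- vector component of the inverse transport. [folklore] -/
@[simp] theorem heisenbergCongr_symm_v (h : Heisenberg B) : ((heisenbergCongr θ hθ).symm h).v = θ.symm h.v := rfl

/-- central component of the inverse transport. [folklore] -/
@[simp] theorem heisenbergCongr_symm_t (h : Heisenberg B) : ((heisenbergCongr θ hθ).symm h).t = h.t := rfl

/-- the transport carries `ofVec v` to `ofVec (θ v)`. [folklore] -/
@[simp] theorem heisenbergCongr_ofVec (v : V') :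
    heisenbergCongr θ hθ (Heisenberg.ofVec B' v) = Heisenberg.ofVec B (θ v) := rfl

include hθ in
/-- the inverse isomorphism is form-compatible too: `B′ (θ⁻¹ v) (θ⁻¹ w) = B v w`. [folklore] -/
theorem compat_symm (v w : V) : B' (θ.symm v) (θ.symm w) = B v w := by
  rw [← hθ, LinearEquiv.apply_symm_apply, LinearEquiv.apply_symm_apply]

/-- the inverse of the transport along `θ` is the transport along `θ⁻¹`. [folklore] -/
theorem heisenbergCongr_symm : (heisenbergCongr θ hθ).symm = heisenbergCongr θ.symm (compat_symm θ hθ) := rfl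

variable [Invertible (2 : R)]

/-- **The transport commutes with Weil's section** `Sp ↪ B₀` (`ofSymplectic`, `f_g(w) = ½(B(gw, gw) − B(w, w))`) and the
conjugation `g ↦ θ g θ⁻¹` of symplectic groups (`symplecticGroupCongr`):
`θ_*((g, f_g) · h) = (θ g θ⁻¹, f_{θgθ⁻¹}) · θ_* h`. [cite: Weil1964, Chap. I n° 5 pp. 150–151] -/
theorem heisenbergCongr_act (g : symplecticGroup B') (h : Heisenberg B') :
    heisenbergCongr θ hθ ((ofSymplectic B' g).act h) =
      (ofSymplectic B (symplecticGroupCongr B' B θ hθ g)).act (heisenbergCongr θ hθ h) := by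
  refine Heisenberg.ext ?_ ?_
  · simp
  · simp [hθ]

variable {k : Type*} [CommRing k] {S : Type*} [AddCommGroup S] [Module k S] {S' : Type*} [AddCommGroup S']
  [Module k S']
variable (ρ : Representation k (Heisenberg B) S) (ρ' : Representation k (Heisenberg B') S')
variable (A : S' ≃ₗ[k] S) (hA : ∀ (h : Heisenberg B') (f : S'), A (ρ' h f) = ρ (heisenbergCongr θ hθ h) (A f))

omit [Invertible (2 : R)] in
include hA in
/-- the intertwining relation for the inverse operator: `A⁻¹ ρ(h) = ρ′(θ⁻¹_* h) A⁻¹`. [folklore] -/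
theorem intertwine_symm (h : Heisenberg B) (f : S) :
    A.symm (ρ h f) = ρ' ((heisenbergCongr θ hθ).symm h) (A.symm f) := by
  rw [LinearEquiv.symm_apply_eq, hA, MulEquiv.apply_symm_apply, LinearEquiv.apply_symm_apply]

omit [Invertible (2 : R)] in
include hA in
/-- the same, spelled with the transport along `θ⁻¹`. [folklore] -/
theorem intertwine_symm' (h : Heisenberg B) (f : S) :
    A.symm (ρ h f) = ρ' (heisenbergCongr θ.symm (compat_symm θ hθ) h) (A.symm f) :=
  intertwine_symm θ hθ ρ ρ' A hA h f

include hA in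
/-- **Transport preserves condition (A)**: if `(g, M) ∈ Mp_ψ(W′)` for the model `ρ′` then
`(θ g θ⁻¹, A M A⁻¹) ∈ Mp_ψ(W)` for the model `ρ`. [cite: MoeglinVignerasWaldspurger1987, Chap. 2 II.1 (A)] -/
theorem MpPsi.transport_mem (p : MpPsi ρ') :
    (symplecticGroupCongr B' B θ hθ (MpPsi.proj ρ' p), (A.symm.trans (MpPsi.toOp ρ' p)).trans A) ∈ MpPsi ρ := by
  rw [mem_MpPsi]
  intro h f
  have hp := (mem_MpPsi ρ' _).1 p.2 ((heisenbergCongr θ hθ).symm h) (A.symm f)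
  simp only [LinearEquiv.trans_apply, MpPsi.proj_apply, MpPsi.toOp_apply]
  rw [intertwine_symm θ hθ ρ ρ' A hA, hp, hA, heisenbergCongr_act, MulEquiv.apply_symm_apply]

/-- the transport as a monoid homomorphism `Mp_ψ(W′) →* Mp_ψ(W)`. [cite: MoeglinVignerasWaldspurger1987, Chap. 2 II.1 (B)] -/
def MpPsi.transportHom : MpPsi ρ' →* MpPsi ρ where
  toFun p := ⟨_, MpPsi.transport_mem θ hθ ρ ρ' A hA p⟩
  map_one' := by
    refine Subtype.ext (Prod.ext ?_ ?_)
    · show symplecticGroupCongr B' B θ hθ (MpPsi.proj ρ' 1) = 1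
      rw [map_one, map_one]
    · show (A.symm.trans (MpPsi.toOp ρ' 1)).trans A = 1
      rw [map_one]
      exact LinearEquiv.ext fun f => by simp
  map_mul' p q := by
    refine Subtype.ext (Prod.ext ?_ ?_)
    · show symplecticGroupCongr B' B θ hθ (MpPsi.proj ρ' (p * q)) =
        symplecticGroupCongr B' B θ hθ (MpPsi.proj ρ' p) * symplecticGroupCongr B' B θ hθ (MpPsi.proj ρ' q)
      rw [map_mul, map_mul]
    · show (A.symm.trans (MpPsi.toOp ρ' (p * q))).trans A =
        (A.symm.trans (MpPsi.toOp ρ' p)).trans A * (A.symm.trans (MpPsi.toOp ρ' q)).trans A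
      rw [map_mul]
      exact LinearEquiv.ext fun f => by simp [LinearEquiv.mul_apply]

/-- formula for the transport homomorphism. [folklore] -/
@[simp] theorem MpPsi.coe_transportHom (p : MpPsi ρ') :
    ((MpPsi.transportHom θ hθ ρ ρ' A hA p : MpPsi ρ) : symplecticGroup B × (S ≃ₗ[k] S)) =
      (symplecticGroupCongr B' B θ hθ (MpPsi.proj ρ' p), (A.symm.trans (MpPsi.toOp ρ' p)).trans A) :=
  rfl

/-- **TRANSPORT OF STRUCTURE `Mp_ψ(W′) ≃* Mp_ψ(W)`** along `(θ, A)`: `(g, M) ↦ (θ g θ⁻¹, A M A⁻¹)`, inverse the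
transport along `(θ⁻¹, A⁻¹)`. [cite: MoeglinVignerasWaldspurger1987, Chap. 2 II.1 (A)–(B)] -/
def MpPsi.transport : MpPsi ρ' ≃* MpPsi ρ :=
  (MpPsi.transportHom θ hθ ρ ρ' A hA).toMulEquiv
    (MpPsi.transportHom θ.symm (compat_symm θ hθ) ρ' ρ A.symm (intertwine_symm' θ hθ ρ ρ' A hA))
    (MonoidHom.ext fun p => Subtype.ext <| Prod.ext (Subtype.ext <| LinearEquiv.ext fun v => by simp)
      (LinearEquiv.ext fun f => by simp))
    (MonoidHom.ext fun p => Subtype.ext <| Prod.ext (Subtype.ext <| LinearEquiv.ext fun v => by simp)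
      (LinearEquiv.ext fun f => by simp))

/-- formula for the transport. [folklore] -/
@[simp] theorem MpPsi.coe_transport (p : MpPsi ρ') :
    ((MpPsi.transport θ hθ ρ ρ' A hA p : MpPsi ρ) : symplecticGroup B × (S ≃ₗ[k] S)) =
      (symplecticGroupCongr B' B θ hθ (MpPsi.proj ρ' p), (A.symm.trans (MpPsi.toOp ρ' p)).trans A) :=
  rfl

/-- formula for the inverse transport. [folklore] -/
@[simp] theorem MpPsi.coe_transport_symm (q : MpPsi ρ) :
    (((MpPsi.transport θ hθ ρ ρ' A hA).symm q : MpPsi ρ') : symplecticGroup B' × (S' ≃ₗ[k] S')) =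
      (symplecticGroupCongr B B' θ.symm (compat_symm θ hθ) (MpPsi.proj ρ q),
        (A.symm.symm.trans (MpPsi.toOp ρ q)).trans A.symm) :=
  rfl

/-- **`π ∘ transport = (θ · θ⁻¹) ∘ π`**. [cite: MoeglinVignerasWaldspurger1987, Chap. 2 II.1 (B)] -/
@[simp] theorem MpPsi.proj_transport (p : MpPsi ρ') :
    MpPsi.proj ρ (MpPsi.transport θ hθ ρ ρ' A hA p) = symplecticGroupCongr B' B θ hθ (MpPsi.proj ρ' p) :=
  rfl

/-- **the transported operator is `A M A⁻¹`**. [cite: MoeglinVignerasWaldspurger1987, Chap. 2 II.1 (B)] -/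
@[simp] theorem MpPsi.toOp_transport (p : MpPsi ρ') :
    MpPsi.toOp ρ (MpPsi.transport θ hθ ρ ρ' A hA p) = (A.symm.trans (MpPsi.toOp ρ' p)).trans A :=
  rfl

/-- pointwise: `toOp (transport p) f = A (toOp p (A⁻¹ f))`. [folklore] -/
theorem MpPsi.toOp_transport_apply (p : MpPsi ρ') (f : S) :
    MpPsi.toOp ρ (MpPsi.transport θ hθ ρ ρ' A hA p) f = A (MpPsi.toOp ρ' p (A.symm f)) :=
  rfl

/-- **the Weil representation is transported by `A`**: `ω_ψ(transport p) f = A (ω_ψ(p) (A⁻¹ f))`.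
[cite: GelbartRogawski1991, §3.1 p. 454] -/
theorem omegaPsi_transport_apply (p : MpPsi ρ') (f : S) :
    omegaPsi ρ (MpPsi.transport θ hθ ρ ρ' A hA p) f = A (omegaPsi ρ' p (A.symm f)) :=
  rfl

variable {X : Type*} (Θ : S → X) (Θ' : S' → X) (hΘ : ∀ f, Θ (A f) = Θ' f)

include hΘ in
/-- **Transport preserves `Θ`-fixing** when `Θ ∘ A = Θ′`: `transport p` fixes `Θ` iff `p` fixes `Θ′`.
[cite: Weil1964, Chap. III n° 41 Thm 6 p. 193] -/
theorem MpPsi.transport_mem_fixing_iff (p : MpPsi ρ') :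
    MpPsi.transport θ hθ ρ ρ' A hA p ∈ MpPsi.fixing ρ Θ ↔ p ∈ MpPsi.fixing ρ' Θ' := by
  rw [MpPsi.mem_fixing_iff, MpPsi.mem_fixing_iff]
  constructor
  · intro H f
    have h1 := H (A f)
    change Θ (A ((p : symplecticGroup B' × (S' ≃ₗ[k] S')).2 (A.symm (A f)))) = Θ (A f) at h1
    rwa [LinearEquiv.symm_apply_apply, hΘ, hΘ] at h1
  · intro H f
    change Θ (A ((p : symplecticGroup B' × (S' ≃ₗ[k] S')).2 (A.symm f))) = Θ f
    rw [hΘ, H, ← hΘ, LinearEquiv.apply_symm_apply]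

end Generic

/-! ## §2 The relabelling `Mp_ψ(W_{T′}) ≃* Mp_ψ(W_T)` of the adelic Schrödinger model (`T C = T′`) -/

section Relabel

variable (F : Type) [Field F] [NumberField F] (ι : Type) [Fintype ι] [DecidableEq ι]
variable {T T' : Matrix ι ι (AdeleRing (𝓞 F) F)} (C : GL ι (AdeleRing (𝓞 F) F))

/-- **The relabelling `Λ_C : (x, y) ↦ (x, C y)`** of `W_𝔸 = 𝔸_F^ι × 𝔸_F^ι` (inverse `(x, y) ↦ (x, C⁻¹ y)`).
[folklore] -/
def relabelVec : ((ι → AdeleRing (𝓞 F) F) × (ι → AdeleRing (𝓞 F) F)) ≃ₗ[AdeleRing (𝓞 F) F]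
    ((ι → AdeleRing (𝓞 F) F) × (ι → AdeleRing (𝓞 F) F)) where
  toFun v := (v.1, (C : Matrix ι ι (AdeleRing (𝓞 F) F)) *ᵥ v.2)
  invFun v := (v.1, ((C⁻¹ : GL ι (AdeleRing (𝓞 F) F)) : Matrix ι ι (AdeleRing (𝓞 F) F)) *ᵥ v.2)
  map_add' v w := Prod.ext rfl (Matrix.mulVec_add _ _ _)
  map_smul' a v := Prod.ext rfl (Matrix.mulVec_smul _ _ _)
  left_inv v := Prod.ext rfl (by
    show ((C⁻¹ : GL ι (AdeleRing (𝓞 F) F)) : Matrix ι ι (AdeleRing (𝓞 F) F)) *ᵥ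
        ((C : Matrix ι ι (AdeleRing (𝓞 F) F)) *ᵥ v.2) = v.2
    rw [Matrix.mulVec_mulVec, Units.inv_mul, Matrix.one_mulVec])
  right_inv v := Prod.ext rfl (by
    show (C : Matrix ι ι (AdeleRing (𝓞 F) F)) *ᵥ
        (((C⁻¹ : GL ι (AdeleRing (𝓞 F) F)) : Matrix ι ι (AdeleRing (𝓞 F) F)) *ᵥ v.2) = v.2
    rw [Matrix.mulVec_mulVec, Units.mul_inv, Matrix.one_mulVec])

/-- formula `Λ_C (x, y) = (x, C y)`. [folklore] -/
@[simp] theorem relabelVec_apply (v : (ι → AdeleRing (𝓞 F) F) × (ι → AdeleRing (𝓞 F) F)) :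
    relabelVec F ι C v = (v.1, (C : Matrix ι ι (AdeleRing (𝓞 F) F)) *ᵥ v.2) := rfl

/-- formula `Λ_C⁻¹ (x, y) = (x, C⁻¹ y)`. [folklore] -/
@[simp] theorem relabelVec_symm_apply (v : (ι → AdeleRing (𝓞 F) F) × (ι → AdeleRing (𝓞 F) F)) :
    (relabelVec F ι C).symm v = (v.1, ((C⁻¹ : GL ι (AdeleRing (𝓞 F) F)) : Matrix ι ι (AdeleRing (𝓞 F) F)) *ᵥ v.2) :=
  rfl

variable (hC : T * (C : Matrix ι ι (AdeleRing (𝓞 F) F)) = T')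

include hC in
/-- `T C = T′` implies `T′ C⁻¹ = T`. [folklore] -/
theorem mul_inv_eq_of_relabel : T' * ((C⁻¹ : GL ι (AdeleRing (𝓞 F) F)) : Matrix ι ι (AdeleRing (𝓞 F) F)) = T := by
  rw [← hC, Matrix.mul_assoc, Units.mul_inv, Matrix.mul_one]

include hC in
/-- **`Λ_C` is form-compatible**: `β_T(x, C y′) = x ⬝ᵥ (T C y′) = β_{T′}(x, y′)`, hence
`polar β_T (Λ_C v) (Λ_C w) = polar β_{T′} v w`. [folklore] -/
theorem polar_relabelVec (v w : (ι → AdeleRing (𝓞 F) F) × (ι → AdeleRing (𝓞 F) F)) :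
    polar (adelicForm F ι T) (relabelVec F ι C v) (relabelVec F ι C w) = polar (adelicForm F ι T') v w := by
  simp only [polar_apply, relabelVec_apply, adelicForm_apply]
  rw [Matrix.mulVec_mulVec, hC]

/-- **The relabelled Schrödinger representation is the original one**: `ρ_T(Λ_C h) = ρ_{T′}(h)` as operators on
`𝒮(𝔸_F^ι)` — `T` enters `ρ_T` only through `T y`, and `T (C y) = T′ y`.
[cite: MoeglinVignerasWaldspurger1987, Chap. 2 I.4 Exemple (1)] -/
theorem adelicSchrodinger_relabel_apply (h : AdelicHeisenberg F ι T') (Φ : piSchwartzBruhat F ι)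
    (u : ι → AdeleRing (𝓞 F) F) :
    ((adelicSchrodinger F ι T (heisenbergCongr (relabelVec F ι C) (polar_relabelVec F ι C hC) h) Φ :
        piSchwartzBruhat F ι) : (ι → AdeleRing (𝓞 F) F) → ℂ) u =
      ((adelicSchrodinger F ι T' h Φ : piSchwartzBruhat F ι) : (ι → AdeleRing (𝓞 F) F) → ℂ) u := by
  rw [adelicSchrodinger_apply, adelicSchrodinger_apply, heisenbergCongr_t, heisenbergCongr_v, relabelVec_apply,
    Matrix.mulVec_mulVec, hC]

/-- the same as an identity of operators on `𝒮(𝔸_F^ι)`. [cite: MoeglinVignerasWaldspurger1987, Chap. 2 I.4 Exemple (1)] -/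
theorem adelicSchrodinger_relabel (h : AdelicHeisenberg F ι T') (Φ : piSchwartzBruhat F ι) :
    adelicSchrodinger F ι T (heisenbergCongr (relabelVec F ι C) (polar_relabelVec F ι C hC) h) Φ =
      adelicSchrodinger F ι T' h Φ :=
  Subtype.ext (funext fun u => adelicSchrodinger_relabel_apply F ι C hC h Φ u)

/-- **THE RELABELLING `Mp_ψ(W_{T′}) ≃* Mp_ψ(W_T)`**, `(g, M) ↦ (Λ_C g Λ_C⁻¹, M)`: the transport of §1 along
`(Λ_C, id)`. [cite: MoeglinVignerasWaldspurger1987, Chap. 2 II.1 (A)–(B)] -/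
def adelicMpRelabel : adelicMp F ι T' ≃* adelicMp F ι T :=
  MpPsi.transport (relabelVec F ι C) (polar_relabelVec F ι C hC) (adelicSchrodinger F ι T) (adelicSchrodinger F ι T')
    (LinearEquiv.refl ℂ (piSchwartzBruhat F ι)) fun h Φ => (adelicSchrodinger_relabel F ι C hC h Φ).symm

/-- **the relabelling does not move the operator**: `toOp (relabel p) = toOp p`. [folklore] -/
@[simp] theorem toOp_adelicMpRelabel (p : adelicMp F ι T') :
    MpPsi.toOp (adelicSchrodinger F ι T) (adelicMpRelabel F ι C hC p) = MpPsi.toOp (adelicSchrodinger F ι T') p :=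
  LinearEquiv.ext fun _ => rfl

/-- hence **the Weil representation is unchanged**: `ω_ψ(relabel p) = ω_ψ(p)`. [cite: GelbartRogawski1991, §3.1 p. 454] -/
@[simp] theorem omegaPsi_adelicMpRelabel (p : adelicMp F ι T') :
    omegaPsi (adelicSchrodinger F ι T) (adelicMpRelabel F ι C hC p) = omegaPsi (adelicSchrodinger F ι T') p :=
  LinearMap.ext fun _ => rfl

/-- **`π(relabel p) = Λ_C π(p) Λ_C⁻¹`** (unitary-2's `symplecticGroupCongr`). [cite: MoeglinVignerasWaldspurger1987, Chap. 2 II.1 (B)] -/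
theorem proj_adelicMpRelabel (p : adelicMp F ι T') :
    MpPsi.proj (adelicSchrodinger F ι T) (adelicMpRelabel F ι C hC p) =
      symplecticGroupCongr _ _ (relabelVec F ι C) (polar_relabelVec F ι C hC) (MpPsi.proj (adelicSchrodinger F ι T') p) :=
  rfl

/-- pointwise: `π(relabel p) w = Λ_C (π(p) (Λ_C⁻¹ w))`, in coordinates. [folklore] -/
theorem coe_proj_adelicMpRelabel_apply (p : adelicMp F ι T') (w : (ι → AdeleRing (𝓞 F) F) × (ι → AdeleRing (𝓞 F) F)) :
    ((MpPsi.proj (adelicSchrodinger F ι T) (adelicMpRelabel F ι C hC p) : symplecticGroup (polar (adelicForm F ι T))) :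
        ((ι → AdeleRing (𝓞 F) F) × (ι → AdeleRing (𝓞 F) F)) ≃ₗ[AdeleRing (𝓞 F) F]
          ((ι → AdeleRing (𝓞 F) F) × (ι → AdeleRing (𝓞 F) F))) w =
      ((((MpPsi.proj (adelicSchrodinger F ι T') p : symplecticGroup (polar (adelicForm F ι T'))) :
          ((ι → AdeleRing (𝓞 F) F) × (ι → AdeleRing (𝓞 F) F)) ≃ₗ[AdeleRing (𝓞 F) F]
            ((ι → AdeleRing (𝓞 F) F) × (ι → AdeleRing (𝓞 F) F))) ((relabelVec F ι C).symm w)).1,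
        (C : Matrix ι ι (AdeleRing (𝓞 F) F)) *ᵥ
          (((MpPsi.proj (adelicSchrodinger F ι T') p : symplecticGroup (polar (adelicForm F ι T'))) :
            ((ι → AdeleRing (𝓞 F) F) × (ι → AdeleRing (𝓞 F) F)) ≃ₗ[AdeleRing (𝓞 F) F]
              ((ι → AdeleRing (𝓞 F) F) × (ι → AdeleRing (𝓞 F) F))) ((relabelVec F ι C).symm w)).2) :=
  rfl

/-- **`Mp_ψ(W_𝔸)ᶜᵒⁿᵗ` is preserved** (same operator). [cite: GelbartRogawski1991, §3.1 p. 454] -/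
theorem adelicMpRelabel_mem_adelicMpCont_iff (p : adelicMp F ι T') :
    adelicMpRelabel F ι C hC p ∈ adelicMpCont F ι T ↔ p ∈ adelicMpCont F ι T' := by
  rw [mem_adelicMpCont_iff, mem_adelicMpCont_iff, toOp_adelicMpRelabel]

/-- **`Θ`-fixing is preserved** (same operator; no rationality of `C` needed). [cite: Weil1964, Chap. III n° 41 Thm 6 p. 193] -/
theorem adelicMpRelabel_mem_adelicMpTheta_iff (p : adelicMp F ι T') :
    adelicMpRelabel F ι C hC p ∈ adelicMpTheta F ι T ↔ p ∈ adelicMpTheta F ι T' :=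
  MpPsi.transport_mem_fixing_iff _ _ _ _ _ _ (thetaDistLM F ι : piSchwartzBruhat F ι → ℂ)
    (thetaDistLM F ι : piSchwartzBruhat F ι → ℂ) (fun _ => rfl) p

/-- **the relabelling is continuous** for the coefficient topologies of `Mp_ψ(W_{T′})`, `Mp_ψ(W_T)` (orbit maps of `π`
are moved by the continuous `Λ_C^{±1}`, matrix coefficients are unchanged). [cite: Weil1964, Chap. III n° 39 p. 189] -/
theorem continuous_adelicMpRelabel : Continuous (adelicMpRelabel F ι C hC) := by
  refine (continuous_into_adelicMp_iff _).2 ⟨fun w => ?_, fun Φ x => ?_⟩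
  · have hc := continuous_proj_apply (F := F) (ι := ι) (T := T') ((relabelVec F ι C).symm w)
    simp only [coe_proj_adelicMpRelabel_apply]
    exact (continuous_fst.comp hc).prodMk (continuous_const.matrix_mulVec (continuous_snd.comp hc))
  · simp only [omegaPsi_adelicMpRelabel]
    exact continuous_omegaPsi_apply Φ x

/-- **Uniqueness against `Θ`-fixing lifts**: if `p ∈ Mp_ψ(W_{T′})^Θ`, `q ∈ Mp_ψ(W_T)^Θ` and `π(q) = Λ_C π(p) Λ_C⁻¹`,
then `relabel p = q` (`π` is injective on the `Θ`-fixing pairs, `adelicMp_eq_of_proj_eq`; `y ↦ T y` surjective).  This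
is how a rational symplectic isometry between `W_{T′}` and `W_T` is absorbed by Weil's rational lift `r_F` inside ONE
group. [cite: Weil1964, Chap. III n° 41 Thm 6 p. 193] -/
theorem adelicMpRelabel_eq_of_proj_eq (hT : Function.Surjective fun y : ι → AdeleRing (𝓞 F) F => T *ᵥ y)
    {p : adelicMp F ι T'} {q : adelicMp F ι T} (hp : p ∈ adelicMpTheta F ι T') (hq : q ∈ adelicMpTheta F ι T)
    (h : MpPsi.proj (adelicSchrodinger F ι T) q =
      symplecticGroupCongr _ _ (relabelVec F ι C) (polar_relabelVec F ι C hC) (MpPsi.proj (adelicSchrodinger F ι T') p)) :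
    adelicMpRelabel F ι C hC p = q :=
  adelicMp_eq_of_proj_eq hT ((adelicMpRelabel_mem_adelicMpTheta_iff F ι C hC p).2 hp) hq
    (by rw [proj_adelicMpRelabel, h])

/-- **The relabelling matrix for two invertible Gram matrices**: `C := T⁻¹ T′ ∈ GL_ι(𝔸_F)`. [folklore] -/
def relabelGL (hT : IsUnit T.det) (hT' : IsUnit T'.det) : GL ι (AdeleRing (𝓞 F) F) :=
  ((Matrix.isUnit_iff_isUnit_det T).2 hT).unit⁻¹ * ((Matrix.isUnit_iff_isUnit_det T').2 hT').unit

/-- `T (T⁻¹ T′) = T′`: the hypothesis `hC` for `relabelGL`. [folklore] -/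
theorem mul_relabelGL (hT : IsUnit T.det) (hT' : IsUnit T'.det) :
    T * (relabelGL F ι hT hT' : Matrix ι ι (AdeleRing (𝓞 F) F)) = T' := by
  rw [relabelGL, Units.val_mul, ← Matrix.mul_assoc, IsUnit.mul_val_inv, Matrix.one_mul, IsUnit.unit_spec]

end Relabel

/-! ## §3 The relabelling on the group of record `Mp_ψ(W_𝔸)ᶜᵒⁿᵗ` -/

section RelabelCont

variable (F : Type) [Field F] [NumberField F] (ι : Type) [Fintype ι] [DecidableEq ι]
variable {T T' : Matrix ι ι (AdeleRing (𝓞 F) F)} (C : GL ι (AdeleRing (𝓞 F) F))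
  (hC : T * (C : Matrix ι ι (AdeleRing (𝓞 F) F)) = T')

/-- **THE RELABELLING OF RECORD `Mp_ψ(W_{T′})ᶜᵒⁿᵗ ≃* Mp_ψ(W_T)ᶜᵒⁿᵗ`** (restriction of `adelicMpRelabel`; LF-continuity is
a property of the operator, which does not move). [cite: GelbartRogawski1991, §3.1 p. 454] -/
def adelicMpContRelabel : adelicMpCont F ι T' ≃* adelicMpCont F ι T where
  toFun p := ⟨adelicMpRelabel F ι C hC p, (adelicMpRelabel_mem_adelicMpCont_iff F ι C hC _).2 p.2⟩
  invFun q := ⟨(adelicMpRelabel F ι C hC).symm q,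
    (adelicMpRelabel_mem_adelicMpCont_iff F ι C hC _).1 (by rw [MulEquiv.apply_symm_apply]; exact q.2)⟩
  left_inv p := Subtype.ext ((adelicMpRelabel F ι C hC).symm_apply_apply _)
  right_inv q := Subtype.ext ((adelicMpRelabel F ι C hC).apply_symm_apply _)
  map_mul' p q := Subtype.ext (map_mul (adelicMpRelabel F ι C hC) _ _)

/-- underlying pair of the relabelling of record. [folklore] -/
@[simp] theorem coe_adelicMpContRelabel (p : adelicMpCont F ι T') :
    ((adelicMpContRelabel F ι C hC p : adelicMpCont F ι T) : adelicMp F ι T) = adelicMpRelabel F ι C hC p :=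
  rfl

/-- underlying pair of the inverse relabelling of record. [folklore] -/
@[simp] theorem coe_adelicMpContRelabel_symm (q : adelicMpCont F ι T) :
    (((adelicMpContRelabel F ι C hC).symm q : adelicMpCont F ι T') : adelicMp F ι T') =
      (adelicMpRelabel F ι C hC).symm q :=
  rfl

/-- **`ω ∘ relabel = ω`** on the group of record. [cite: GelbartRogawski1991, §3.1 p. 454] -/
theorem adelicMpCont.omega_relabel (p : adelicMpCont F ι T') :
    adelicMpCont.omega F ι T (adelicMpContRelabel F ι C hC p) = adelicMpCont.omega F ι T' p := by
  simp only [adelicMpCont.omega_apply, coe_adelicMpContRelabel, omegaPsi_adelicMpRelabel]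

/-- **`π ∘ relabel = (Λ_C · Λ_C⁻¹) ∘ π`** on the group of record. [cite: GelbartRogawski1991, §3.1 p. 454] -/
theorem adelicMpCont.proj_relabel (p : adelicMpCont F ι T') :
    adelicMpCont.proj F ι T (adelicMpContRelabel F ι C hC p) =
      symplecticGroupCongr _ _ (relabelVec F ι C) (polar_relabelVec F ι C hC) (adelicMpCont.proj F ι T' p) :=
  rfl

/-- `Θ`-fixing along the relabelling of record. [cite: Weil1964, Chap. III n° 41 Thm 6 p. 193] -/
theorem coe_adelicMpContRelabel_mem_adelicMpTheta_iff (p : adelicMpCont F ι T') :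
    ((adelicMpContRelabel F ι C hC p : adelicMpCont F ι T) : adelicMp F ι T) ∈ adelicMpTheta F ι T ↔
      (p : adelicMp F ι T') ∈ adelicMpTheta F ι T' :=
  adelicMpRelabel_mem_adelicMpTheta_iff F ι C hC p

/-- **the relabelling of record is continuous** (subspace topologies). [cite: Weil1964, Chap. III n° 39 p. 189] -/
theorem continuous_adelicMpContRelabel : Continuous (adelicMpContRelabel F ι C hC) :=
  (continuous_into_adelicMpCont_iff _).2 ((continuous_adelicMpRelabel F ι C hC).comp continuous_subtype_val)

/-- and so is its inverse (the relabelling along `C⁻¹`, up to the identification `relabel⁻¹ = relabel_{C⁻¹}`): a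
homeomorphic group isomorphism. [cite: Weil1964, Chap. III n° 39 p. 189] -/
theorem continuous_adelicMpContRelabel_symm : Continuous (adelicMpContRelabel F ι C hC).symm := by
  have h : Continuous (adelicMpRelabel F ι C hC).symm := by
    refine (continuous_into_adelicMp_iff _).2 ⟨fun w => ?_, fun Φ x => ?_⟩
    · have hc := continuous_proj_apply (F := F) (ι := ι) (T := T) (relabelVec F ι C w)
      have e : ∀ q : adelicMp F ι T,
          ((MpPsi.proj (adelicSchrodinger F ι T') ((adelicMpRelabel F ι C hC).symm q) :
              symplecticGroup (polar (adelicForm F ι T'))) :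
            ((ι → AdeleRing (𝓞 F) F) × (ι → AdeleRing (𝓞 F) F)) ≃ₗ[AdeleRing (𝓞 F) F]
              ((ι → AdeleRing (𝓞 F) F) × (ι → AdeleRing (𝓞 F) F))) w =
          ((((MpPsi.proj (adelicSchrodinger F ι T) q : symplecticGroup (polar (adelicForm F ι T))) :
              ((ι → AdeleRing (𝓞 F) F) × (ι → AdeleRing (𝓞 F) F)) ≃ₗ[AdeleRing (𝓞 F) F]
                ((ι → AdeleRing (𝓞 F) F) × (ι → AdeleRing (𝓞 F) F))) (relabelVec F ι C w)).1,
            ((C⁻¹ : GL ι (AdeleRing (𝓞 F) F)) : Matrix ι ι (AdeleRing (𝓞 F) F)) *ᵥ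
              (((MpPsi.proj (adelicSchrodinger F ι T) q : symplecticGroup (polar (adelicForm F ι T))) :
                ((ι → AdeleRing (𝓞 F) F) × (ι → AdeleRing (𝓞 F) F)) ≃ₗ[AdeleRing (𝓞 F) F]
                  ((ι → AdeleRing (𝓞 F) F) × (ι → AdeleRing (𝓞 F) F))) (relabelVec F ι C w)).2) := fun q => rfl
      simp only [e]
      exact (continuous_fst.comp hc).prodMk (continuous_const.matrix_mulVec (continuous_snd.comp hc))
    · have e : ∀ q : adelicMp F ι T,
          ((omegaPsi (adelicSchrodinger F ι T') ((adelicMpRelabel F ι C hC).symm q) Φ : piSchwartzBruhat F ι) :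
            (ι → AdeleRing (𝓞 F) F) → ℂ) x =
          ((omegaPsi (adelicSchrodinger F ι T) q Φ : piSchwartzBruhat F ι) : (ι → AdeleRing (𝓞 F) F) → ℂ) x :=
        fun q => rfl
      simp only [e]
      exact continuous_omegaPsi_apply Φ x
  exact (continuous_into_adelicMpCont_iff _).2 (h.comp continuous_subtype_val)

end RelabelCont

end Literature.NumberTheory.Weil1964
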